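import Literature.AlgebraicGeometry.HodgeTheory.MotivatedClassesDeformation
import Literature.AlgebraicGeometry.HodgeTheory.SmoothProjectiveFamilyGenericBase
import Literature.AlgebraicGeometry.HodgeTheory.SupportPropagationDominantCurve
import Literature.AlgebraicGeometry.Motives.CurveThroughTwoPointsNonSeparated
import HarnessLib

/-!
# Propagation of algebraicity along a smooth curve base, for a family defined over a countable field:
# one algebraic fibre over the generic point ⟹ every fibre algebraic

Voisin, *Hodge Theory II*, §3.3.1 and Charles–Schnell 2014, proof of Prop. 11.3.11 (for a smooth PROPER family
`f = f₀ ⊗_σ ℂ : 𝒳 ⟶ S` with projective fibres over a smooth irreducible affine curve `S = S₀ ⊗_σ ℂ`, `k`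
countable, `σ : k →+* ℂ`): if `A ∈ H²ᵖ(𝒳(ℂ); ℂ)` is algebraic on ONE fibre `𝒳_s` with `s` over the generic
point of `S₀`, then `A|_{𝒳_u}` is algebraic at EVERY complex point `u` of `S`.

Part 1 (`k` algebraically closed — **`everywherePropagation_of_isAlgClosed`**):
1. `A|_{𝒳_s}` dies off a closed `V ⊆ 𝒳_s` of codimension `≥ p`; spread `V` to a closed `Z ⊆ 𝒲₀ = 𝒳₀ ×_{S₀} T₀`
   over a smooth affine integral `T₀` dominating `S₀`, with a complex point `t` of `T = T₀ ⊗ ℂ` over the generic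
   point of `T₀`, `h(t) = s`, `𝒲_t ≅ 𝒳_s` carrying the slice `Z_t` to `V`
   (`exists_spread_isClosed_fiberOver_generic_smooth`); death of `q^*A` off `Z` is constant over the complex
   points of `T` above a `k`-rational open `O₀ ∋ η_{T₀}` (`map_fiberι_mem_ker_restrictCompl_iff_of_baseChangeHom'`),
   so it holds over all of `O = pr⁻¹ O₀ ∋ t`; the slice over `t` has codimension `≥ p`.
2. (**`mem_algebraicClasses_of_good_open`**) `h : T → S` is dominant, so the images of the complex points of `T` are
   uncountable (`ComplexPoints.not_countable_image_of_isDominant_of_smoothCurve`); pick `t'` with `h t' ≠ h t`.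
   MUMFORD'S CURVE LEMMA (*Abelian Varieties* §6; the tree's unconditional
   `mumford_smoothCurve_through_two_points_of_irreducibleSpace_of_smooth`) gives a smooth irreducible affine curve
   `γ : C → T` through `t` and `t'`; `φ = γ ≫ h : C → S` hits two distinct closed points, hence is DOMINANT
   (`isDominant_of_apply_eq_of_apply_ne`). Pull the family and the supports back to `C` (`familyPullback`,
   `fiberOverFamilyPullbackIso`): death holds over the non-empty open `γ⁻¹ O ∋ a'` (`γ a' = t`) and the slice over
   `a'` has codimension `≥ p`; the tree's `mem_algebraicClasses_of_dominant_curve` (`SupportPropagationDominantCurve`: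
   the dominating pieces of the image of the supports in `𝒳 × C` are flat over `C` of the right dimension; push to
   `𝒳 × S`, close up, upper semicontinuity of supports + SGA1 XII 2.2 over the curve `S`) gives algebraicity of
   `A|_{𝒳_u}` at every `u`.

Part 2 (any countable `k` — `everywherePropagation_of_factor`, **`everywherePropagation`**): pass to the algebraic
closure `k' = k̄` (countable, integral over `k`): the two complexifications are isomorphic families
(`baseChangeHomObjIsoOfComp`), the base hypotheses and the conclusion move along the isomorphism
(`SmoothProjectiveFamilyGenericBase` Part 1) and a point over the generic point of `S₀` is over the generic point of
`S₀ ⊗ k'` (`closure_base_pt_eq_univ_of_factor`).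

Theorems only: no definition, no named fact; namespace `Literature.AlgebraicGeometry.HodgeTheory.AlgebraicityLocusPropagation`.

Provenance: Literature home of the Summits-side `HodgeConjecture/Theorems/AnchorTransportVariationalHodgePadicEverywherePropagation`
and of §General of `…/AnchorTransportVariationalHodgePadicGenericPropagationProper` (imports `Literature/`, Mathlib and
the bookkeeping now in `HodgeTheory/SmoothProjectiveFamilyGenericBase`); the route-specific corollaries ("stub G")
stay Summits-side. Lane `lit-hodgefound`, seat p20.

## References
* [VoisinHodgeII2003] C. Voisin, *Hodge Theory and Complex Algebraic Geometry II* (2003), §3.3.1.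
* [CharlesSchnell2014Notes] F. Charles, C. Schnell, *Notes on absolute Hodge classes* (2014), Prop. 11.3.11 (proof),
  Lemma 11.3.14.
* [MumfordAV1970] D. Mumford, *Abelian Varieties* (1970), §6, Lemma (smooth curve through two points).
-/

noncomputable section

namespace Literature.AlgebraicGeometry.HodgeTheory.AlgebraicityLocusPropagation

/-! ## Part 1: Everywhere propagation, `k` algebraically closed -/

section Part1

open _root_.CategoryTheory _root_.CategoryTheory.Limits _root_.AlgebraicGeometry TopologicalSpace _root_.Order
open Literature.AlgebraicGeometry.Motives Literature.AlgebraicGeometry.HodgeTheory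

/-! ### A curve through the spread point: from one good open of the parameter variety to every fibre -/

section Curve

variable {𝒳 S T 𝒲 : SchemeOver ℂ} (f : 𝒳 ⟶ S) (h : T ⟶ S) (q : 𝒲 ⟶ 𝒳) (g : 𝒲 ⟶ T)

/-- **From death over a good open of a dominating parameter variety to EVERY fibre, through a
Mumford curve.** Let `f : 𝒳 ⟶ S` be a smooth projective family of relative dimension `n` over a
smooth integral AFFINE curve `S` (total space only proper over `S`), `(q, g; f, h)` a cartesian
square with `T` smooth, irreducible and separated over `ℂ` and `h` dominant, `Z ⊆ 𝒲` closed,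
`A ∈ H²ᵖ(𝒳(ℂ); ℂ)`, `O ⊆ T` open such that `(q^* A)|_{𝒲_y}` dies off the slice `ι_y⁻¹ Z` for every
complex point `y` of `O`, and `t ∈ O` a complex point whose slice has codimension `≥ p`
(`height + p ≤ n`). Then `A|_{𝒳_u}` is algebraic at every complex point `u` of `S`: a second
complex point `t'` with `h t' ≠ h t` exists (the image of `T(ℂ)` is uncountable), Mumford's lemma
gives a smooth affine curve `γ : C → T` through `t, t'`, `γ ≫ h` is dominant, and the tree's
`mem_algebraicClasses_of_dominant_curve` applies to the family and supports pulled back to `C`.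
[cite: MumfordAV1970, §6, Lemma] [cite: VoisinHodgeII2003, §3.3.1]
[cite: CharlesSchnell2014Notes, Prop. 11.3.11 (proof)] -/
theorem mem_algebraicClasses_of_good_open {n : ℕ} (hf : IsSmoothProjectiveFamily f n)
    [IsAffine S.left] [IsIntegral S.left] [SmoothOfRelativeDimension 1 S.hom]
    [IrreducibleSpace T.left] [AlgebraicGeometry.Smooth T.hom] [IsSeparated T.hom]
    [IsDominant h.left] (H : IsPullback q g f h) (p : ℕ) (A : complexBetti 𝒳 (2 * p))
    {Z : Set 𝒲.left} (hZ : IsClosed Z) {O : Set T.left} (hO : IsOpen O)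
    (hdeath : ∀ y : ComplexPoints T, y.pt ∈ O →
      complexBetti.restrictCompl (fiberOver g y) ((fiberι g y).left.base ⁻¹' Z) (2 * p)
        (complexBetti.map (fiberι g y) (2 * p) (complexBetti.map q (2 * p) A)) = 0)
    (t : ComplexPoints T) (ht : t.pt ∈ O)
    (hcodim : ∀ z : (fiberOver g t).left, (fiberι g t).left.base z ∈ Z → height z + p ≤ (n : ℕ∞))
    (u : ComplexPoints S) :
    complexBetti.map (fiberι f u) (2 * p) A ∈ algebraicClasses (fiberOver f u) p := by
  classical
  haveI : AlgebraicGeometry.Smooth S.hom := SmoothOfRelativeDimension.smooth 1 S.hom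
  haveI : LocallyOfFiniteType S.hom := inferInstance
  haveI : LocallyOfFiniteType T.hom := inferInstance
  -- ### a second complex point of `T` with a different image in `S`
  obtain ⟨t', ht'⟩ : ∃ t' : ComplexPoints T, AlgPoints.map h t' ≠ AlgPoints.map h t := by
    by_contra hall
    refine ComplexPoints.not_countable_image_of_isDominant_of_smoothCurve h ⊤ ⟨t, trivial⟩ ?_
    refine (Set.countable_singleton (AlgPoints.map h t)).mono ?_
    rintro _ ⟨x, -, rfl⟩
    exact Set.mem_singleton_iff.2 (not_not.1 fun hx => hall ⟨x, hx⟩)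
  -- ### Mumford's smooth affine curve through `t` and `t'`
  obtain ⟨C, γ, a', b', hCaff, hCirr, hCsm, hCdim, ha', hb'⟩ :=
    mumford_smoothCurve_through_two_points_of_irreducibleSpace_of_smooth (S := T) t t'
  subst ha' hb'
  haveI := hCaff
  haveI := hCirr
  haveI := hCsm
  haveI : IsIntegral C.left := isIntegral_of_irreducibleSpace_of_smooth C
  haveI : SmoothOfRelativeDimension 1 C.hom :=
    smoothOfRelativeDimension_one_of_topologicalKrullDim C hCdim
  -- `γ ≫ h : C ⟶ S` is dominant: its image contains two distinct closed points
  haveI : IsDominant (γ ≫ h).left := by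
    refine isDominant_of_apply_eq_of_apply_ne (T := S) (γ ≫ h).left a'.pt b'.pt
      (a := (AlgPoints.map (γ ≫ h) a').pt) rfl fun hpt => ht' ?_
    rw [← AlgPoints.map_comp_apply, ← AlgPoints.map_comp_apply]
    exact pt_injective S (a₁ := AlgPoints.map (γ ≫ h) b') (a₂ := AlgPoints.map (γ ≫ h) a') hpt
  -- ### the family and the supports pulled back to `C`
  let gC : familyPullback g γ ⟶ C := familyPullback.snd g γ
  let qW : familyPullback g γ ⟶ 𝒲 := familyPullback.fst g γ
  have HC : IsPullback (qW ≫ q) gC f (γ ≫ h) := (familyPullback.isPullback g γ).paste_horiz H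
  have hZC : IsClosed (qW.left.base ⁻¹' Z) := hZ.preimage qW.left.continuous
  -- fibres of the pulled-back family: `(𝒲 ×_T C)_c ≅ 𝒲_{γ c}`, compatibly with the slices
  have hfib : ∀ c : ComplexPoints C,
      (fiberι gC c).left.base ⁻¹' (qW.left.base ⁻¹' Z) =
        (fiberOverFamilyPullbackIso g γ c).hom.left.base ⁻¹'
          ((fiberι g (AlgPoints.map γ c)).left.base ⁻¹' Z) := fun c => by
    ext z
    have hc := congrArg (fun ψ => ψ.left.base z) (fiberOverFamilyPullbackIso_hom_fiberι g γ c)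
    simp only [Over.comp_left, Scheme.Hom.comp_base, TopCat.coe_comp, Function.comp_apply] at hc
    simp only [Set.mem_preimage]
    rw [hc]
  -- death over the open `γ⁻¹ O ∋ a'`
  have hUo : IsOpen (γ.left.base ⁻¹' O) := hO.preimage γ.left.continuous
  have haU : a'.pt ∈ γ.left.base ⁻¹' O := ht
  have hdeathC : ∀ c : ComplexPoints C, c.pt ∈ γ.left.base ⁻¹' O →
      complexBetti.restrictCompl (fiberOver gC c) ((fiberι gC c).left.base ⁻¹' (qW.left.base ⁻¹' Z))
        (2 * p) (complexBetti.map (fiberι gC c) (2 * p)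
          (complexBetti.map (qW ≫ q) (2 * p) A)) = 0 := by
    intro c hc
    have hy := hdeath (AlgPoints.map γ c) hc
    have hqq : complexBetti.map (qW ≫ q) (2 * p) A =
        complexBetti.map qW (2 * p) (complexBetti.map q (2 * p) A) := by
      rw [complexBetti.map_comp]; rfl
    rw [hqq, map_fiberι_map_eq_map_of_fiberIso g qW gC (fiberOverFamilyPullbackIso g γ c)
      (fiberOverFamilyPullbackIso_hom_fiberι g γ c) (2 * p), hfib c]
    exact complexBetti.restrictCompl_map_eq_zero _ hy
  -- codimension of the slice over `a'`
  have haC : ∀ z : (fiberOver gC a').left,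
      (fiberι gC a').left.base z ∈ qW.left.base ⁻¹' Z → height z + p ≤ (n : ℕ∞) := by
    intro z hz
    haveI : IsIso (fiberOverFamilyPullbackIso g γ a').hom.left :=
      (inferInstance : IsIso ((Over.forget _).mapIso (fiberOverFamilyPullbackIso g γ a')).hom)
    have hz' : z ∈ (fiberOverFamilyPullbackIso g γ a').hom.left.base ⁻¹'
        ((fiberι g (AlgPoints.map γ a')).left.base ⁻¹' Z) := by
      rw [← hfib a']; exact hz
    rw [← height_base_eq_of_isClosedImmersion' (fiberOverFamilyPullbackIso g γ a').hom.left z]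
    exact hcodim _ hz'
  -- ### the curve theorem over `S`
  exact mem_algebraicClasses_of_dominant_curve f (γ ≫ h) (qW ≫ q) gC hf
    (IsQuasiProjectiveOver.of_isAffine S) HC p A hZC hUo ⟨a'.pt, haU⟩ hdeathC a' haC u

end Curve

/-! ### Everywhere propagation, `k` algebraically closed -/

section AlgClosed

/-- **Propagation from a fibre over the generic point to EVERY fibre, for an algebraically closed
countable field of definition — no quasi-projectivity of the total space.** Let `k` be a
countable algebraically closed field, `σ : k →+* ℂ`, `f₀ : 𝒳₀ ⟶ S₀` over `k` whose
complexification `f : 𝒳 ⟶ S` is a smooth projective family of relative dimension `n` (smooth,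
PROPER, projective fibres) over a smooth irreducible affine curve, `A ∈ H²ᵖ(𝒳(ℂ); ℂ)` and
`s ∈ S(ℂ)` over the generic point of `S₀` with `A|_{𝒳_s}` algebraic. Then `A|_{𝒳_u}` is algebraic
at every complex point `u` (spread of the support, death constancy over a `k`-rational open,
codimension at the spread point, then `mem_algebraicClasses_of_good_open`; module docstring steps
1–2). [cite: VoisinHodgeII2003, §3.3.1] [cite: CharlesSchnell2014Notes, Prop. 11.3.11 (proof) and Lemma 11.3.14]
[cite: MumfordAV1970, §6, Lemma] -/
theorem everywherePropagation_of_isAlgClosed (k : Type) [Field k] [Countable k] [IsAlgClosed k]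
    (σ : k →+* ℂ) ⦃n : ℕ⦄ ⦃𝒳₀ S₀ : SchemeOver k⦄ (f₀ : 𝒳₀ ⟶ S₀)
    (hf : IsSmoothProjectiveFamily ((baseChangeHom σ).map f₀) n)
    (hirr : IrreducibleSpace ((baseChangeHom σ).obj S₀).left)
    (haff : IsAffine ((baseChangeHom σ).obj S₀).left)
    (hsm : AlgebraicGeometry.Smooth ((baseChangeHom σ).obj S₀).hom)
    (hdim : topologicalKrullDim ((baseChangeHom σ).obj S₀).left = 1)
    (p : ℕ) (A : complexBetti ((baseChangeHom σ).obj 𝒳₀) (2 * p))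
    (s : ComplexPoints ((baseChangeHom σ).obj S₀))
    (hs : closure {(baseChangeHomFst σ S₀).base s.pt} = (Set.univ : Set S₀.left))
    (hA : complexBetti.map (fiberι ((baseChangeHom σ).map f₀) s) (2 * p) A ∈
      algebraicClasses (fiberOver ((baseChangeHom σ).map f₀) s) p)
    (u : ComplexPoints ((baseChangeHom σ).obj S₀)) :
    complexBetti.map (fiberι ((baseChangeHom σ).map f₀) u) (2 * p) A ∈
      algebraicClasses (fiberOver ((baseChangeHom σ).map f₀) u) p := by
  classical
  letI := σ.toAlgebra
  haveI := hirr
  haveI := haff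
  haveI := hsm
  haveI : CharZero k := σ.charZero
  -- ### notation and standing instances
  let 𝒳 : SchemeOver ℂ := (baseChangeHom σ).obj 𝒳₀
  let S : SchemeOver ℂ := (baseChangeHom σ).obj S₀
  let f : 𝒳 ⟶ S := (baseChangeHom σ).map f₀
  let prS : S.left ⟶ S₀.left := baseChangeHomFst σ S₀
  haveI : LocallyOfFiniteType S₀.hom := locallyOfFiniteType_of_smooth_baseChangeHom σ S₀
  haveI : IrreducibleSpace S₀.left := irreducibleSpace_of_baseChangeHom σ S₀
  haveI : IsIntegral S.left := isIntegral_of_irreducibleSpace_of_smooth S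
  haveI : IsIntegral S₀.left := isIntegral_of_baseChangeHom σ S₀
  haveI : SmoothOfRelativeDimension 1 S.hom :=
    smoothOfRelativeDimension_one_of_topologicalKrullDim S hdim
  haveI : IsAffineHom S.hom := isAffineHom_of_isAffine S.hom
  haveI : IsSeparated S.hom := inferInstance
  haveI : IsProper f.left := hf.isProper
  haveI : AlgebraicGeometry.Smooth f.left := hf.smooth
  haveI : IsProper f₀.left := isProper_of_baseChangeHom_map σ f₀
  haveI : AlgebraicGeometry.Smooth f₀.left := smooth_of_baseChangeHom_map σ f₀
  haveI : Surjective prS := (surjective_flat_quasiCompact_baseChangeHomFst σ S₀).1.1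
  -- `s` lies over the generic point
  have hs' : prS s.pt = genericPoint S₀.left := base_pt_eq_genericPoint_of_closure_eq σ S₀ s hs
  -- ### step 1: the support of `A|_{𝒳_s}` and its spread
  obtain ⟨V, hVc, hVp, hV0⟩ := mem_supportedClasses_iff_exists.1 hA
  have hfs : IsSmoothProjective n (fiberOver f s) := hf.isSmoothProjective s
  haveI := IsSmoothProjective.isLocallyNoetherian_holds hfs
  haveI := IsSmoothProjective.compactSpace_holds hfs
  haveI : IsNoetherian (fiberOver f s).left := {}
  have hVcpt : IsCompact Vᶜ := NoetherianSpace.isCompact _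
  obtain ⟨T₀, 𝒲₀, hT₀aff, hT₀int, hT₀sm, h₀, hlft, hdom, g₀, q₀, Z, t, e, Hsq, hZ, hts, hgen,
    hcomp, hslice⟩ := exists_spread_isClosed_fiberOver_generic_smooth σ f₀ s hs' hVc hVcpt
  haveI := hT₀aff
  haveI := hT₀int
  haveI := hlft
  haveI := hdom
  haveI : AlgebraicGeometry.Smooth T₀.hom := hT₀sm
  -- ### instances for the parameter scheme and the spread family
  let T : SchemeOver ℂ := (baseChangeHom σ).obj T₀
  let 𝒲 : SchemeOver ℂ := (baseChangeHom σ).obj 𝒲₀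
  let g : 𝒲 ⟶ T := (baseChangeHom σ).map g₀
  let q : 𝒲 ⟶ 𝒳 := (baseChangeHom σ).map q₀
  let h : T ⟶ S := (baseChangeHom σ).map h₀
  let prT : T.left ⟶ T₀.left := baseChangeHomFst σ T₀
  let prW : 𝒲.left ⟶ 𝒲₀.left := baseChangeHomFst σ 𝒲₀
  haveI : IrreducibleSpace T.left := irreducibleSpace_baseChangeHom_left σ (X := T₀)
  haveI : AlgebraicGeometry.Smooth T.hom := smooth_baseChangeHom_hom σ (X := T₀)
  obtain ⟨d, hd⟩ := exists_smoothOfRelativeDimension_of_smooth (f := T₀.hom)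
  haveI := hd
  haveI : LocallyOfFiniteType T₀.hom := by rw [← Over.w h₀]; infer_instance
  haveI : IsAffineHom T₀.hom := isAffineHom_of_isAffine T₀.hom
  haveI : IsSeparated T₀.hom := inferInstance
  haveI : CompactSpace T₀.left := QuasiCompact.compactSpace_of_compactSpace T₀.hom
  haveI : IsProper g₀.left := MorphismProperty.of_isPullback (P := @IsProper) Hsq inferInstance
  haveI : AlgebraicGeometry.Smooth g₀.left :=
    MorphismProperty.of_isPullback (P := @AlgebraicGeometry.Smooth) Hsq inferInstance
  haveI : LocallyOfFiniteType T.hom := by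
    change LocallyOfFiniteType (pullback.snd T₀.hom (Spec.map (CommRingCat.ofHom σ)))
    infer_instance
  haveI : IsSeparated T.hom := by
    change IsSeparated (pullback.snd T₀.hom (Spec.map (CommRingCat.ofHom σ)))
    infer_instance
  have HsqC : IsPullback q g f h := isPullback_baseChangeHom_map_of_isPullback' σ Hsq
  -- ### step 2: death constancy over a `k`-rational open; death and codimension at `t`
  let A' : complexBetti 𝒲 (2 * p) := complexBetti.map q (2 * p) A
  obtain ⟨O₀, hηO₀, hconst⟩ :=
    map_fiberι_mem_ker_restrictCompl_iff_of_baseChangeHom' σ g₀ (d := d) Z hZ (2 * p) A'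
  let Zc : Set 𝒲.left := (prW : 𝒲.left → 𝒲₀.left) ⁻¹' Z
  have hZc : IsClosed Zc := hZ.preimage prW.continuous
  have hslice' : e.hom.left.base ⁻¹' V = (fiberι g t).left.base ⁻¹' Zc := by
    change ⇑e.hom.left ⁻¹' V = ⇑(fiberι g t).left ⁻¹' (⇑prW ⁻¹' Z)
    rw [hslice, Scheme.Hom.comp_base, TopCat.coe_comp, Set.preimage_comp]
  have htO₀ : prT t.pt ∈ O₀ := by
    change baseChangeHomFst σ T₀ t.pt ∈ O₀
    rw [hgen]; exact hηO₀
  have hdeath_t : complexBetti.restrictCompl (fiberOver g t) ((fiberι g t).left.base ⁻¹' Zc) (2 * p)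
      (complexBetti.map (fiberι g t) (2 * p) A') = 0 :=
    restrictCompl_map_fiberι_map_eq_zero_of_fiberIso f q g e hcomp hslice' A hV0
  have hdeathT : ∀ y : ComplexPoints T, y.pt ∈ prT.base ⁻¹' (O₀ : Set T₀.left) →
      complexBetti.restrictCompl (fiberOver g y) ((fiberι g y).left.base ⁻¹' Zc) (2 * p)
        (complexBetti.map (fiberι g y) (2 * p) (complexBetti.map q (2 * p) A)) = 0 :=
    fun y hyO => LinearMap.mem_ker.1 ((hconst t y htO₀ hyO).1 (LinearMap.mem_ker.2 hdeath_t))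
  have hcodim_t : ∀ z : (fiberOver g t).left, (fiberι g t).left.base z ∈ Zc →
      height z + p ≤ (n : ℕ∞) :=
    fun z hz => forall_height_add_le_of_fiberIso f g hfs e hslice' hVp z hz
  -- ### step 3: `h` is dominant; conclude through a Mumford curve
  haveI : IsDominant h.left := by
    have Hh : IsPullback prT h.left h₀.left prS := (isPullback_baseChange_map_left ℂ h₀).flip
    have hT₀ : h₀.left (genericPoint T₀.left) = genericPoint S₀.left :=
      genericPoint_eq_of_isDominant' h₀.left
    have hS : prS (genericPoint S.left) = genericPoint S₀.left := genericPoint_eq_of_isDominant' prS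
    obtain ⟨z, -, hz⟩ := Scheme.Pullback.exists_preimage_pullback (f := h₀.left) (g := prS)
      (genericPoint T₀.left) (genericPoint S.left) (by rw [hT₀, hS])
    refine isDominant_of_apply_eq_genericPoint h.left (v := Hh.isoPullback.inv z) ?_
    rw [← Scheme.Hom.comp_apply, IsPullback.isoPullback_inv_snd]
    exact hz
  exact mem_algebraicClasses_of_good_open f h q g hf HsqC p A hZc
    (O₀.2.preimage prT.continuous) hdeathT t htO₀ hcodim_t u

end AlgClosed

end Part1

/-! ## Part 2: Everywhere propagation, any countable field of definition -/

section Part2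

open _root_.CategoryTheory _root_.CategoryTheory.Limits _root_.AlgebraicGeometry TopologicalSpace _root_.Order
open Literature.AlgebraicGeometry.Motives Literature.AlgebraicGeometry.HodgeTheory

/-! ### Everywhere propagation, any countable field of definition -/

section General

variable {k k' : Type} [Field k] [Field k'] (σ : k →+* ℂ) (σ' : k →+* k') (τ : k' →+* ℂ)

/-- **Everywhere propagation along a factorisation `k → k' → ℂ`** with `k'` countable, algebraically
closed and integral over `k`: the statement of `everywherePropagation` for the family over `k`,
deduced from `everywherePropagation_of_isAlgClosed` for its base change to `k'` (the two
complexifications are isomorphic families, `baseChangeHomObjIsoOfComp_comm`; all hypotheses and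
the conclusion move along the isomorphism, and `s` stays over the generic point,
`closure_base_pt_eq_univ_of_factor`). [cite: VoisinHodgeII2003, §3.3.1]
[cite: CharlesSchnell2014Notes, Prop. 11.3.11 (proof) and Lemma 11.3.14] -/
theorem everywherePropagation_of_factor [Countable k'] [IsAlgClosed k'] (hσ' : σ'.IsIntegral)
    (hτσ : τ.comp σ' = σ) ⦃n : ℕ⦄ ⦃𝒳₀ S₀ : SchemeOver k⦄ (f₀ : 𝒳₀ ⟶ S₀)
    (hf : IsSmoothProjectiveFamily ((baseChangeHom σ).map f₀) n)
    (hirr : IrreducibleSpace ((baseChangeHom σ).obj S₀).left)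
    (haff : IsAffine ((baseChangeHom σ).obj S₀).left)
    (hsm : AlgebraicGeometry.Smooth ((baseChangeHom σ).obj S₀).hom)
    (hdim : topologicalKrullDim ((baseChangeHom σ).obj S₀).left = 1)
    (p : ℕ) (A : complexBetti ((baseChangeHom σ).obj 𝒳₀) (2 * p))
    (s : ComplexPoints ((baseChangeHom σ).obj S₀))
    (hs : closure {(baseChangeHomFst σ S₀).base s.pt} = (Set.univ : Set S₀.left))
    (hA : complexBetti.map (fiberι ((baseChangeHom σ).map f₀) s) (2 * p) A ∈
      algebraicClasses (fiberOver ((baseChangeHom σ).map f₀) s) p)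
    (u : ComplexPoints ((baseChangeHom σ).obj S₀)) :
    complexBetti.map (fiberι ((baseChangeHom σ).map f₀) u) (2 * p) A ∈
      algebraicClasses (fiberOver ((baseChangeHom σ).map f₀) u) p := by
  classical
  -- ### the isomorphism of complex families `(f₀ ⊗ k') ⊗ ℂ ≅ f₀ ⊗ ℂ`
  have comm : (baseChangeHom τ).map ((baseChangeHom σ').map f₀) ≫
      (baseChangeHomObjIsoOfComp σ' τ σ hτσ S₀).hom =
      (baseChangeHomObjIsoOfComp σ' τ σ hτσ 𝒳₀).hom ≫ (baseChangeHom σ).map f₀ :=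
    baseChangeHomObjIsoOfComp_comm σ' τ σ hτσ f₀
  -- ### transport of the hypotheses
  haveI := hirr
  haveI := haff
  haveI := hsm
  have hf' : IsSmoothProjectiveFamily ((baseChangeHom τ).map ((baseChangeHom σ').map f₀)) n :=
    IsSmoothProjectiveFamily.of_arrowIso _ _ comm hf
  obtain ⟨hirr', haff', hsm', hdim'⟩ :=
    base_hypotheses_of_iso (S' := (baseChangeHom τ).obj ((baseChangeHom σ').obj S₀))
      (baseChangeHomObjIsoOfComp σ' τ σ hτσ S₀) hdim
  have hA' := (map_fiberι_mem_algebraicClasses_iff_of_arrowIso _ _ comm A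
      (AlgPoints.map_hom_map_inv_apply (baseChangeHomObjIsoOfComp σ' τ σ hτσ S₀) s)).mpr hA
  haveI := hirr'
  haveI := hsm'
  have hs' := closure_base_pt_eq_univ_of_factor σ σ' τ hσ' hτσ S₀ s hs
  -- ### the algebraically closed case at `eS⁻¹ u`, and transport of the conclusion
  have key := everywherePropagation_of_isAlgClosed k' τ ((baseChangeHom σ').map f₀) hf' hirr'
    haff' hsm' hdim' p _ _ hs' hA'
    (AlgPoints.map (baseChangeHomObjIsoOfComp σ' τ σ hτσ S₀).inv u)
  exact (map_fiberι_mem_algebraicClasses_iff_of_arrowIso _ _ comm A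
    (AlgPoints.map_hom_map_inv_apply (baseChangeHomObjIsoOfComp σ' τ σ hτσ S₀) u)).1 key

/-- **EVERYWHERE PROPAGATION**, every countable field of definition `k`, no quasi-projectivity:
for `f₀ ⊗_σ ℂ : 𝒳 ⟶ S` a smooth projective family (smooth, proper, projective fibres) over a
smooth irreducible affine curve, `A ∈ H²ᵖ(𝒳(ℂ); ℂ)` and a complex point `s` over the generic
point of `S₀` with `A|_{𝒳_s}` algebraic, `A|_{𝒳_u}` is algebraic at every complex point `u`
(factor `σ` through the algebraic closure of `k` in `ℂ`, `exists_countable_isAlgClosed_factor`,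
and apply `everywherePropagation_of_factor`). [cite: VoisinHodgeII2003, §3.3.1]
[cite: CharlesSchnell2014Notes, Prop. 11.3.11 (proof) and Lemma 11.3.14] -/
theorem everywherePropagation (k : Type) [Field k] [Countable k] (σ : k →+* ℂ) ⦃n : ℕ⦄
    ⦃𝒳₀ S₀ : SchemeOver k⦄ (f₀ : 𝒳₀ ⟶ S₀)
    (hf : IsSmoothProjectiveFamily ((baseChangeHom σ).map f₀) n)
    (hirr : IrreducibleSpace ((baseChangeHom σ).obj S₀).left)
    (haff : IsAffine ((baseChangeHom σ).obj S₀).left)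
    (hsm : AlgebraicGeometry.Smooth ((baseChangeHom σ).obj S₀).hom)
    (hdim : topologicalKrullDim ((baseChangeHom σ).obj S₀).left = 1)
    (p : ℕ) (A : complexBetti ((baseChangeHom σ).obj 𝒳₀) (2 * p))
    (s : ComplexPoints ((baseChangeHom σ).obj S₀))
    (hs : closure {(baseChangeHomFst σ S₀).base s.pt} = (Set.univ : Set S₀.left))
    (hA : complexBetti.map (fiberι ((baseChangeHom σ).map f₀) s) (2 * p) A ∈
      algebraicClasses (fiberOver ((baseChangeHom σ).map f₀) s) p)
    (u : ComplexPoints ((baseChangeHom σ).obj S₀)) :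
    complexBetti.map (fiberι ((baseChangeHom σ).map f₀) u) (2 * p) A ∈
      algebraicClasses (fiberOver ((baseChangeHom σ).map f₀) u) p := by
  obtain ⟨k', _, _, _, σ', τ, hσ', hτσ⟩ := exists_countable_isAlgClosed_factor σ
  exact everywherePropagation_of_factor σ σ' τ hσ' hτσ f₀ hf hirr haff hsm hdim p A s hs hA u

end General

end Part2

end Literature.AlgebraicGeometry.HodgeTheory.AlgebraicityLocusPropagation

end
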